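import Literature.AlgebraicGeometry.Hyperkaehler.TotalCohomologyLefschetzModule
import Literature.AlgebraicGeometry.Hyperkaehler.LLVGenerationTransport
import Literature.AlgebraicGeometry.HodgeTheory.ChernCharacterBetti
import Literature.AlgebraicTopology.SingularHomology.CupProductProofs
import HarnessLib

/-!
# Lefschetz transfer, topological core: cup powers of a sum of pulled-back classes, and the top power of a
class restricted along a section of a cover (lane (V), seam S3 `KummerDivisorClassLefschetz` of the line
`Cruxes/LefschetzGenerationKum4/Lines/laneV.lean`, crux `stmt-Ventures-19134`)

Cell `hodge-kum4` (ladder HodgeAV rung H3).  Seam S3 asks that the restriction `θ*D_α` to the generalized Kummer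
fibre `j : K ⟶ A^[n+1]` of the divisor class `D_α` of a polarization `α` of the abelian surface `A` has a dual
Lefschetz operator.  The proof is `D3 ∘ T`: D3 (`HilbertScheme.ChernCharacterOperators.isDualLefschetz_transferOp`,
in the tree) makes `D_α` a Lefschetz class on `A^[n+1]` for EVERY instance of the interface; the transfer lemma `T`
says that for ANY Lefschetz class `ℓ ∈ H²(A^[n+1])` the top power `(θ*ℓ)^{2n} ∈ H^{4n}(K)` is non-zero, whence `θ*ℓ`
is Lefschetz by the Verbitsky–Looijenga–Lunts–Fujiki criterion on the irreducible symplectic `K`.  This file is the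
TOPOLOGICAL CORE of `T`, free of schemes, Hilbert schemes and instances:

* `commute_totalLefschetz` — Lefschetz operators of degree-two classes commute (`⌣` is graded commutative);
* `lefschetzPow_eq_cupProduct_cupPowTwo`, `totalLefschetz_pow_eq_zero` — `L_aʲ x = aʲ ⌣ x`, so `aʲ = 0 ⟹ L_aʲ = 0`;
* `cupPowTwo_add_eq_zero` — **if `u^{r+1} = 0` and `vˢ = 0` in `H*(P)` then `(u + v)^{r+s} = 0`** (binomial theorem
  for the commuting operators `L_u`, `L_v`: every term of `(L_u + L_v)^{r+s}` contains `L_u^{r+1}` or `L_vˢ`);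
* `cupPowTwo_ne_zero_of_add_decomposition` — **the cover step**: if `Θ : P → Y_H` is injective on `H^{2(r+s)}`,
  every `a ∈ H²(Y_A)` has `a^{r+1} = 0` (`Y_A` a real `2r`-…: for the abelian surface `r = 2`, `a³ = 0`),
  `ℓ^{r+s} ≠ 0` on `Y_H` and `Θ*ℓ = p_A^* a + p_K^* b`, then `bˢ ≠ 0` on `Y_K`;
* `eq_map_of_add_decomposition` — with a section `ι : Y_K → P` of `p_K` along which `p_A^*` kills `H²`, the summand
  `b` IS `(Θ ∘ ι)^* ℓ` (for the Kummer cover: `Θ ∘ (e, id) = j`, so `b = θ*ℓ`).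

The geometric instantiation (Beauville's cover `Θ : A × K → A^[n+1]`, Künneth in degree `2`, `b₁(K) = 0`, the
Lefschetz criterion) is the sequel `KummerFixedLocusKummerDivisorClassLefschetz.lean`.  HONEST FRAMING: kernel
lemmas only; nothing here asserts S3, V0, L1, `HC_Kum4Type` or HC.
-/

noncomputable section

open DirectSum
open Literature.AlgebraicTopology.SingularHomology
open Literature.Geometry.Kaehler
open Literature.AlgebraicGeometry Literature.AlgebraicGeometry.Hyperkaehler
open Literature.AlgebraicGeometry.HodgeTheory (cupPowTwo)

namespace Summit.Ventures.HodgeKum4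

variable {Y : Type} [TopologicalSpace Y]

/-! ### Plumbing -/

/-- Re-indexing a homogeneous cup product along equal target degrees. -/
private theorem ofDegree_cupProduct_reindex {p q n m : ℕ} (h₁ : p + q = n) (h₂ : p + q = m)
    (x : singularCohomology ℂ ℂ Y p) (y : singularCohomology ℂ ℂ Y q) :
    ofDegree ℂ Y n (cupProduct h₁ x y) = ofDegree ℂ Y m (cupProduct h₂ x y) := by
  subst h₁; subst h₂; rfl

/-- `L_aʲ 1 = aʲ` on `H*(Y) = ⨁ₖ Hᵏ(Y)` (private copy of the plumbing lemma of
`Hyperkaehler/LefschetzClassesIrreducibleSymplectic.lean`, to keep this file independent of it). -/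
private theorem pow_apply_unit (a : singularCohomology ℂ ℂ Y 2) (j : ℕ) :
    (totalLefschetz a ^ j) (ofDegree ℂ Y 0 (singularCohomology.one ℂ Y)) = ofDegree ℂ Y (2 * j) (cupPowTwo a j) := by
  induction j with
  | zero => rw [pow_zero, Module.End.one_apply, HodgeTheory.cupPowTwo_zero]
  | succ j ih =>
    rw [pow_succ', Module.End.mul_apply, ih, totalLefschetz_lof, lefschetzOperator_apply, HodgeTheory.cupPowTwo_succ,
      cupProduct_gradedComm_holds ℂ Y (Nat.add_comm 2 (2 * j)) (HodgeTheory.two_mul_add_two j) a (cupPowTwo a j)]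
    have hsign : ((-1 : ℂ) ^ (2 * (2 * j))) = 1 := by
      rw [pow_mul]
      norm_num
    rw [hsign, one_smul]
    exact ofDegree_cupProduct_reindex _ _ _ _

/-! ### Lefschetz operators commute, and `L_aʲ` is cup product with `aʲ` -/

/-- **Lefschetz operators of degree-two classes commute**: `L_a L_b = L_b L_a` on `H*(Y; ℂ)`
(`a ⌣ (b ⌣ x) = (a ⌣ b) ⌣ x = (b ⌣ a) ⌣ x = b ⌣ (a ⌣ x)`, graded commutativity in even degrees).
Looijenga–Lunts regard `H²` as "a graded abelian Lie algebra which is homogeneous of degree two" acting on `H*`. -/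
theorem commute_totalLefschetz (a b : singularCohomology ℂ ℂ Y 2) : Commute (totalLefschetz a) (totalLefschetz b) := by
  change totalLefschetz a * totalLefschetz b = totalLefschetz b * totalLefschetz a
  refine DirectSum.linearMap_ext ℂ fun k ↦ LinearMap.ext fun x ↦ ?_
  simp only [LinearMap.coe_comp, Function.comp_apply, Module.End.mul_apply, totalLefschetz_lof,
    lefschetzOperator_apply]
  -- `a ⌣ (b ⌣ x) = (a ⌣ b) ⌣ x` and `b ⌣ (a ⌣ x) = (b ⌣ a) ⌣ x`, then `a ⌣ b = b ⌣ a`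
  rw [← cupProduct_assoc (show 2 + 2 = 4 by rfl) (Nat.add_comm 2 k) (show 4 + k = k + 2 + 2 by omega)
      (Nat.add_comm 2 (k + 2)) a b x,
    ← cupProduct_assoc (show 2 + 2 = 4 by rfl) (Nat.add_comm 2 k) (show 4 + k = k + 2 + 2 by omega)
      (Nat.add_comm 2 (k + 2)) b a x,
    cupProduct_gradedComm_holds ℂ Y (show 2 + 2 = 4 by rfl) (show 2 + 2 = 4 by rfl) a b]
  have hsign : ((-1 : ℂ) ^ (2 * 2)) = 1 := by norm_num
  rw [hsign, one_smul]

/-- **`L_aʲ x = aʲ ⌣ x`**: the iterated Lefschetz operator is cup product (on the left) with the cup power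
`aʲ = cupPowTwo a j` (associativity and graded commutativity in even degrees). -/
theorem lefschetzPow_eq_cupProduct_cupPowTwo (a : singularCohomology ℂ ℂ Y 2) (j k : ℕ)
    (x : singularCohomology ℂ ℂ Y k) :
    lefschetzPow a j k x = cupProduct (show 2 * j + k = k + 2 * j by omega) (cupPowTwo a j) x := by
  induction j with
  | zero =>
    rw [lefschetzPow_zero, LinearMap.id_apply, HodgeTheory.cupPowTwo_zero]
    exact (one_cupProduct x).symm
  | succ j ih =>
    rw [lefschetzPow_succ, LinearMap.comp_apply, ih, lefschetzOperator_apply, HodgeTheory.cupPowTwo_succ,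
      ← cupProduct_assoc (show 2 + 2 * j = 2 * j + 2 by omega) (show 2 * j + k = k + 2 * j by omega)
        (show 2 * j + 2 + k = k + 2 * (j + 1) by omega) (show 2 + (k + 2 * j) = k + 2 * (j + 1) by omega)
        a (cupPowTwo a j) x,
      cupProduct_gradedComm_holds ℂ Y (show 2 + 2 * j = 2 * j + 2 by omega) (HodgeTheory.two_mul_add_two j) a
        (cupPowTwo a j)]
    have hsign : ((-1 : ℂ) ^ (2 * (2 * j))) = 1 := by
      rw [pow_mul]
      norm_num
    rw [hsign, one_smul]

/-- **`aʲ = 0 ⟹ L_aʲ = 0`** as an operator on the total cohomology. -/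
theorem totalLefschetz_pow_eq_zero {a : singularCohomology ℂ ℂ Y 2} {j : ℕ} (h : cupPowTwo a j = 0) :
    totalLefschetz a ^ j = 0 := by
  refine DirectSum.linearMap_ext ℂ fun k ↦ LinearMap.ext fun x ↦ ?_
  simp only [LinearMap.coe_comp, Function.comp_apply, LinearMap.zero_comp, LinearMap.zero_apply]
  rw [pow_totalLefschetz_ofDegree, lefschetzPow_eq_cupProduct_cupPowTwo, h, map_zero, LinearMap.zero_apply, map_zero]

/-! ### Cup powers of a sum -/

/-- **If `u^{r+1} = 0` and `vˢ = 0` then `(u + v)^{r+s} = 0`** (`u, v ∈ H²(Y; ℂ)`).  Proof: `L_{u+v} = L_u + L_v`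
with `L_u`, `L_v` commuting, so `(L_u + L_v)^{r+s} = Σₘ C(r+s, m) L_uᵐ L_v^{r+s-m}` (binomial theorem), and each
term has `m ≥ r + 1` (so contains `L_u^{r+1} = 0`) or `r + s - m ≥ s` (so contains `L_vˢ = 0`); apply to `1`. -/
theorem cupPowTwo_add_eq_zero (u v : singularCohomology ℂ ℂ Y 2) {r s : ℕ} (hu : cupPowTwo u (r + 1) = 0)
    (hv : cupPowTwo v s = 0) : cupPowTwo (u + v) (r + s) = 0 := by
  have hLu : totalLefschetz u ^ (r + 1) = 0 := totalLefschetz_pow_eq_zero hu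
  have hLv : totalLefschetz v ^ s = 0 := totalLefschetz_pow_eq_zero hv
  have hsum : totalLefschetz (u + v) ^ (r + s) = 0 := by
    rw [totalLefschetz_add, (commute_totalLefschetz u v).add_pow]
    refine Finset.sum_eq_zero fun m _ ↦ ?_
    by_cases hm : r + 1 ≤ m
    · obtain ⟨t, rfl⟩ : ∃ t, m = (r + 1) + t := ⟨m - (r + 1), by omega⟩
      rw [pow_add, hLu, zero_mul, zero_mul, zero_mul]
    · have hsm : r + s - m = s + (r - m) := by omega
      rw [hsm, pow_add, hLv, zero_mul, mul_zero, zero_mul]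
  have h1 := LinearMap.congr_fun hsum (ofDegree ℂ Y 0 (singularCohomology.one ℂ Y))
  rw [pow_apply_unit, LinearMap.zero_apply] at h1
  exact DirectSum.of_injective (β := fun k ↦ singularCohomology ℂ ℂ Y k) (2 * (r + s)) (h1.trans (map_zero _).symm)

/-! ### The cover step -/

section Cover

variable {P Y_A Y_K Y_H : Type} [TopologicalSpace P] [TopologicalSpace Y_A] [TopologicalSpace Y_K]
  [TopologicalSpace Y_H]

/-- **The cover step of the Lefschetz transfer.**  Let `Θ : P → Y_H`, `p_A : P → Y_A`, `p_K : P → Y_K` be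
continuous maps with `Θ^*` injective on `H^{2(r+s)}` (a finite covering: transfer), suppose every `a ∈ H²(Y_A; ℂ)`
has `a^{r+1} = 0` (`Y_A` has no cohomology in degree `2r + 2`), and let `ℓ ∈ H²(Y_H; ℂ)` with `ℓ^{r+s} ≠ 0` decompose
as `Θ^*ℓ = p_A^* a + p_K^* b`.  Then `bˢ ≠ 0` in `H^{2s}(Y_K; ℂ)`: otherwise `(p_A^* a)^{r+1} = p_A^*(a^{r+1}) = 0` and
`(p_K^* b)ˢ = p_K^*(bˢ) = 0` give `Θ^*(ℓ^{r+s}) = (p_A^* a + p_K^* b)^{r+s} = 0` (`cupPowTwo_add_eq_zero`), so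
`ℓ^{r+s} = 0`. -/
theorem cupPowTwo_ne_zero_of_add_decomposition (Θ : C(P, Y_H)) (p_A : C(P, Y_A)) (p_K : C(P, Y_K)) {r s : ℕ}
    (hinj : Function.Injective (singularCohomology.map ℂ ℂ Θ (2 * (r + s))))
    (hA : ∀ a : singularCohomology ℂ ℂ Y_A 2, cupPowTwo a (r + 1) = 0) {ℓ : singularCohomology ℂ ℂ Y_H 2}
    (hℓ : cupPowTwo ℓ (r + s) ≠ 0) {a : singularCohomology ℂ ℂ Y_A 2} {b : singularCohomology ℂ ℂ Y_K 2}
    (hdec : singularCohomology.map ℂ ℂ Θ 2 ℓ = singularCohomology.map ℂ ℂ p_A 2 a + singularCohomology.map ℂ ℂ p_K 2 b) :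
    cupPowTwo b s ≠ 0 := by
  intro hb
  have hu : cupPowTwo (singularCohomology.map ℂ ℂ p_A 2 a) (r + 1) = 0 := by
    rw [← HodgeTheory.map_cupPowTwo, hA a, map_zero]
  have hv : cupPowTwo (singularCohomology.map ℂ ℂ p_K 2 b) s = 0 := by
    rw [← HodgeTheory.map_cupPowTwo, hb, map_zero]
  have h0 : singularCohomology.map ℂ ℂ Θ (2 * (r + s)) (cupPowTwo ℓ (r + s)) = 0 := by
    rw [HodgeTheory.map_cupPowTwo, hdec, cupPowTwo_add_eq_zero _ _ hu hv]
  exact hℓ (hinj (h0.trans (map_zero _).symm))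

/-- **The summand along the fibre is the restriction**: if moreover `ι : Y_K → P` is a section of `p_K`
(`p_K ∘ ι = id`) along which `p_A^*` kills `H²` (`(p_A ∘ ι)^* = 0` on `H²`, e.g. `p_A ∘ ι` constant), then
`b = (Θ ∘ ι)^* ℓ`. -/
theorem eq_map_of_add_decomposition (Θ : C(P, Y_H)) (p_A : C(P, Y_A)) (p_K : C(P, Y_K)) (ι : C(Y_K, P))
    (hιK : p_K.comp ι = ContinuousMap.id Y_K)
    (hιA : ∀ a : singularCohomology ℂ ℂ Y_A 2, singularCohomology.map ℂ ℂ (p_A.comp ι) 2 a = 0)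
    {ℓ : singularCohomology ℂ ℂ Y_H 2} {a : singularCohomology ℂ ℂ Y_A 2} {b : singularCohomology ℂ ℂ Y_K 2}
    (hdec : singularCohomology.map ℂ ℂ Θ 2 ℓ = singularCohomology.map ℂ ℂ p_A 2 a + singularCohomology.map ℂ ℂ p_K 2 b) :
    b = singularCohomology.map ℂ ℂ (Θ.comp ι) 2 ℓ := by
  have h := congrArg (singularCohomology.map ℂ ℂ ι 2) hdec
  rw [map_add, ← ModuleCat.comp_apply, ← ModuleCat.comp_apply, ← ModuleCat.comp_apply,
    ← singularCohomology.map_comp, ← singularCohomology.map_comp, ← singularCohomology.map_comp, hιA a, zero_add,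
    hιK, singularCohomology.map_id, ModuleCat.id_apply] at h
  exact h.symm

end Cover

end Summit.Ventures.HodgeKum4

end
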